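import Summits.Ventures.QEC.Census.BB.BB72.Cert
import HarnessLib

/-!
# `BB72`: the checker ACCEPTS the certificate — tier COMPILED (CHECKED-native), emitted by qec-search-7

`checkDistCert cert = true` closed by `native_decide`: this adds the axiom `Lean.ofReduceBool` (trust in the Lean
compiler), so by HOME/plan/CERT-REQS.md §2 / director D3 the corollaries below are **CHECKED-native, never counted as
CERTIFIED**; the KERNEL-tier files (`decide`, chunked per CERT-FORMAT §7) supersede this file and it is then redundant but
stays (append-only tree). Certificate id `7e943c5a566adc43`; claimed n = 72, dZ = 6, dX = 6.
Soundness used: `DistCert.dZ_code` / `DistCert.dX_code` (type-10, `CertCheck.lean`): the CSS code `cert.code _` (= `CSSCode.ofMatrices (rowMatrix n cert.HX) (rowMatrix n cert.HZ) _`) over `Fin 72`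
with check matrices `rowMatrix 72 cert.HX`, `rowMatrix 72 cert.HZ` has `dZ = 6` and `dX = 6`.
-/

namespace Summit.Ventures.QEC.Census.BB72

/-- The checker accepts the `BB72` certificate — by `native_decide` (tier COMPILED / CHECKED-native: axiom
`Lean.ofReduceBool`; NOT the certified tier). -/
theorem checkDistCert_cert_native : cert.checkDistCert = true := by
  native_decide

/-- `d_Z = 6` for the CSS code of the `BB72` certificate (check matrices `rowMatrix 72 cert.HX/HZ` over `Fin 72`) —
tier COMPILED (depends on `checkDistCert_cert_native`, axiom `Lean.ofReduceBool`). -/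
theorem dZ_eq_native : (cert.code (cert.commOK_of_check checkDistCert_cert_native)).dZ = 6 :=
  cert.dZ_code checkDistCert_cert_native

/-- `d_X = 6` for the CSS code of the `BB72` certificate — tier COMPILED (axiom `Lean.ofReduceBool`). -/
theorem dX_eq_native : (cert.code (cert.commOK_of_check checkDistCert_cert_native)).dX = 6 :=
  cert.dX_code checkDistCert_cert_native

end Summit.Ventures.QEC.Census.BB72
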